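import Mathlib
import HarnessLib
import HarnessLib.Audit
import Summits.QuantumAdvantage.Statement
import Summits.QuantumAdvantage.AdviceFreeQNC0.AdviceFreeQNC0
import Summits.QuantumAdvantage.AdviceFreeQNC0.RingHardOdd
import Summits.QuantumAdvantage.AdviceFreeQNC0.AdviceFreeQNC0Three
import Summits.QuantumAdvantage.AdviceFreeQNC0.AffBells37PolyLoss
import Summits.QuantumAdvantage.AdviceFreeQNC0.AffBells23NearPerfect
import Summits.QuantumAdvantage.AdviceFreeQNC0.BondTwistLocal
import Summits.QuantumAdvantage.QuantumAdvantage.Theorems.RingFrameBridge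
import HarnessLib.Audit.Status.Attr

/-!
Route: ExactnessDial

# Route ExactnessDial — Odd-class polynomial loss (junction PolyLossOddU3, shared with ProductDial)
from the exact grade plus a one-loss-to-polynomial-loss step (rung F-Q1-p3, shape B)

DECOMPOSITION CELL decomp-qadv (D-0178/D-0179), RESIDUAL MODE, node ExactnessDial SHAPE B (lens
decomp-qadv-lens-1-g2, NODE 2026-08-30T02:41:27Z,
ADDENDUM v2 02:54:55Z; critic decomp-qadv-crit-1 g2 CLEARED row 10 02:47:34Z and RULED 02:58:45Z
«shape B is the preferred filing: residual strictly
below T, row-9 class»). RUNG CURRENCY ONLY — nothing here bears on the root `QuantumAdvantage`.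
Refines-child of the sibling rung route ProductDial
at its shared junction item PolyLossOddU3 (odd-class polynomial loss with ONE exponent at every
polylog degree; NECESSARY for `RingHardOdd 3`,
C = 1), filed AFTER ProductDial is born; the deciding theorem concludes the rung leaf F-Q1-p3
`AdviceFreeQNC0Three` through ProductDial's
direct-product lift DPLift3 and many-ring bridge MultiRingBridge3 (shared items) and the landed
`Theorems.adviceFreeQNC0Sep_of_hlfNotFAC0Mod`.
It suffices to show X = NoPerfectOdd3 ∧ MassStep3u (⟺ PolyLossOddU3, lens kernel `node_iff_B`): the
EXACT GRADE of the odd-class loss dial at every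
polylog degree AND the step «one loss ⇒ polynomial loss with one exponent» (declared residual of
PolyLossOddU3-grade, NOT T-grade).
Lean: `∃ C : ℕ, ∀ c : ℕ, ∃ n₀ : ℕ, ∀ n ≥ n₀, ∀ P : Fin n →
Literature.Computability.MetaComplexity.Smolensky.CubeFn (ZMod 3) n, (∀ i, P i ∈
Literature.Computability.MetaComplexity.Smolensky.lowDeg (ZMod 3) n ((Nat.log 2 n) ^ c)) →
((Finset.univ.filter fun x : Fin n → Bool => Summit.QuantumAdvantage.AdviceFreeQNC0.OddZeros x ∧
Literature.Computability.QuantumComplexity.RingHLF.Rel x (fun i => decide (P i x = 1))).card : ℝ) ≤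
(1 - 1 / (n : ℝ) ^ C) * (2 : ℝ) ^ (n - 1)`

## Assembly
Inside `closes` (glue_B.lean, one line, 0 sorry): `Theorems.adviceFreeQNC0Sep_of_hlfNotFAC0Mod (hB
(hD (hO (hM hN))))` — MassStep3u applied to
NoPerfectOdd3 gives the junction PolyLossOddU3, OddToAll3 turns it into ProductDial's PolyLoss3,
DPLift3 gives MultiRingHard3, MultiRingBridge3 gives
HLFNotFAC0Mod 3, and the landed ring-frame theorem gives AdviceFreeQNC0Sep 3 = AdviceFreeQNC0Three
(Iff.rfl). Binders consumed 5/5 (open cruxes: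
NoPerfectOdd3, MassStep3u, DPLift3; supports: OddToAll3 provable-now, MultiRingBridge3). Lens kernel
evidence: `closes_B` (ExactnessDial.lean :794,
sha256 8a96d18abf6e6f69c71d5853e1358d0a0b8c9ec533851eb84f8869e5bf7aa4eb), seam `node_iff_B` :676,
necessity `polyLossOdd3u_of_ringHardOdd` :645.

CLOSES_TARGET: closes rung F-Q1-p3 of QuantumAdvantage: Summit.QuantumAdvantage.AdviceFreeQNC0.AdviceFreeQNC0Three (D-0061; not the summit Statement) — the deciding theorem of this route concludes that registered leaf instead of the Statement decl `QuantumAdvantage` (class rung: servable and labelled, never counted as concluding the summit Statement).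

Rationale: WHY THIS LINE. Same mechanism as shape A (the loss dial of `RingHardOdd 3` read from its EXACT end,
where the only all-N theorem-grade point of the p = 3 dial
sits: `noPerfectAt_one` ⟸ tree `AffBells37.affBellsPolyLoss3`, while T's δ ≡ 1 slice
`BondTwist3.RingAffineBellsLt3` is OPEN), but the
T-grade half of the old residual (ConstStep3: polynomial ⇒ constant loss = the fibre method's
ceiling, TwoModuliDepthTwo-adjacent) is REPLACED by
ProductDial's many-ring bypass: ExactnessDial supplies PolyLossOddU3 = NoPerfectOdd3 ∧ MassStep3u,
ProductDial supplies PolyLossOddU3 → PolyLoss3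
(`polyLoss3_of_polyLossOddU3`, k := C+1, even class ≤ 2^(n−1) by `card_even_class_le` — PROVED in
both lens files, `ExactnessDial.PolyLossOdd3u ↔
ProductDial.PolyLossOddU3 := Iff.rfl` per the critic's merged farm check) → DPLift3 →
MultiRingBridge3 → leaf. Imported area and sources as shape A:
polynomial method / exact representations over two moduli (doi:10.1145/28395.28404,
doi:10.1007/BF01200404, arXiv:1704.00690 §4, arXiv:1911.02555),
the p = 2 sibling's exact law `fullSpan_perfect_iff` as transfer target, the exact-grade normal form
`rel_iff_subcubeParity`; direct products /
XOR lemmas for low-degree polynomials (Viola–Wigderson ToC 2008 doi:10.4086/toc.2008.v004a007) enter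
only through ProductDial's DPLift3. Versus
the negatives index: no u-walk (`WalkHardF 3`), no named θ (`RingHardOddHalf`). No new T-grade
residual enters the tree: MassStep3u is of
PolyLossOddU3-grade and its honest failure mode (an n^(−ω(1))-loss family) is a census question
(E2/E3 min-loss decay, REQUIRED at birth).

RANKED CRUXES. #0 PolyLossOddU3 (target) — THE JUNCTION X (shared with ProductDial's layer 2; critic
grammar 02:48:23Z, ∃C ∀c — the STRONG quantifier order ProductDial's direct product needs): ONE
exponent C such that at every polylog output degree (log₂ n)^c, for all large n, every 𝔽₃-polynomial
strategy wins at most (1 − n^(−C))·2^(n−1) of the ODD patterns of the n-cycle ring relation.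
NECESSARY for T = `RingHardOdd 3` (C := 1, lens kernels `polyLossOdd3u_of_ringHardOdd` /
`polyLossOddU3_of_ringHardOdd`); implies ProductDial's PolyLoss3 (OddToAll3, k := C+1) and lens-1's
PolyLossOdd3 trivially; its degree-1 slice is the tree theorem `AffBells37.affBellsPolyLoss3` ON THE
NOSE (lens-5 `oddLossAt_one`); `ExactnessDial.PolyLossOdd3u ↔ ProductDial.PolyLossOddU3 := Iff.rfl`
(critic merged farm check 02:59:21Z). Here X ⟺ NoPerfectOdd3 ∧ MassStep3u (`node_iff_B`). [deps:
NoPerfectOdd3, MassStep3u] [difficulty: open-problem] (why it might fail: false iff either the exact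
grade fails (a perfect polylog-degree family) or some family loses only an n^(−ω(1)) fraction of the
odd class; nothing is known above output degree 1.) [arXiv:1704.00690,
BarringtonStraubingTherien1990, doi:10.4086/toc.2008.v004a007]
#2 NoPerfectOdd3 (crux) — PIECE 1, the EXACT GRADE of the loss dial at every polylog degree: for
every c, for all large n, no 𝔽₃-polynomial strategy with outputs of degree ≤ (log₂ n)^c (output bits
z_i = [P_i(x) = 1]) satisfies the n-cycle ring relation `RingHLF.Rel` on every odd pattern.
NECESSARY (lens kernel `noPerfectOdd3_of_ringHardOdd`) · WEAKER-GENUINE (exact vs constant loss; its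
δ ≡ 1 slice `noPerfectAt_one` is a THEOREM while T's δ ≡ 1 slice `RingAffineBellsLt3` is open) ·
OPEN above degree 1, critic-tested NOT a theorem shadow (only the affine cell and the LOCAL cells
`ringLocal_polylog_lt3` / `ringLocalJunta_polylog_lt3` are landed; a PERFECT affine strategy exists
at N = 7, `AffBells23.perfect_seven`, so any proof is genuinely asymptotic) · FLOOR-FREE ·
QUANTUM-CONTENTFUL · ATTACK = IDEA-NEEDED at the two-moduli seam (first lemma
`rel_iff_subcubeParity` proved; transfer target `fullSpan_perfect_iff`; first non-transferring step:
𝔽₃-selectors [P = 1] = 2t + 2t² have no 𝔽₂-character-span description) · INSTRUMENTABLE (finite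
𝔽₃-variety per (N, d); census tests: E1 shift-covariant affine N = 8…20 = ladder data n*_cov(1) only
(finite-N shadow of the theorem `noPerfectAt_one`); E2 covariant affine + s ≤ 3 quadratic monomials
N = 8…14 and E3 full affine N = 8 via the algebraic encoding = the open-content probes) · first open
rung = the exact grade at quadratic outputs, NoPerfectAt (fun _ => 2) (critic row 10: cleaner than
PolyLossTwo3, not TwoModuliDepthTwo-adjacent). [difficulty: open-problem] (why it might fail: an
N-extensible family of PERFECT quadratic (or bounded-degree, non-local) strategies may exist for
infinitely many N — a perfect affine one exists at N = 7 — which would refute the parent RingHardOdd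
3 itself.) [arXiv:1704.00690, doi:10.1007/BF01200404, doi:10.1145/28395.28404, arXiv:1911.02555]
#3 MassStep3u (crux) — PIECE 2′, DECLARED-RESIDUAL(NoPerfectOdd3) of PolyLossOddU3-grade (NOT
T-grade; seam `node_iff_B : PolyLossOddU3 ↔ NoPerfectOdd3 ∧ MassStep3u`): ONE LOSS ⇒ POLYNOMIAL LOSS
with one exponent for all polylog degrees — if no polylog-degree 𝔽₃ strategy is perfect on the odd
class, then some C bounds the odd-class win count of every polylog-degree strategy by (1 −
n^(−C))·2^(n−1). Vacuous-NECESSARY (`massStep3u_of_ringHardOdd`); at δ ≡ 1 BOTH ends are theorems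
(`noPerfectAt_one`; ProductDial `oddLossAt_one` = AffBells37). Mechanism question of record:
globalise the cell's per-fibre dichotomy «exact-or-polynomial-loss ON A FIBRE»
(`ParityModTestDensity.two_pow_le_card_filter_parityMod3_coset`, ROUND-38P2 Thm 38.Z) from affine
fibres to polylog-degree strategies — IDEA-NEEDED; UNDECIDED with census test «minimum odd-class
loss in the E2/E3 classes, N = 8…20: N^(−C) decay vs sub-polynomial vs 0». [deps: NoPerfectOdd3]
[difficulty: open-problem] (why it might fail: a polylog-degree family losing a non-zero but
n^(−ω(1)) fraction of the odd inputs refutes it while NoPerfectOdd3 survives; nothing is known above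
output degree 1 and no amplification for two-moduli games is in print.)
[BarringtonStraubingTherien1990, arXiv:1704.00690, doi:10.1016/j.jcss.2004.01.003]
#4 DPLift3 (crux) — SHARED NODE = ProductDial's crux DPLift3 (item stmt-QuantumAdvantage-26124, rank
3 there, DECLARED-RESIDUAL of T*-grade; identical signature ⇒ one ledger item wanted by both routes;
staffed via ProductDial): direct-product lift from one-ring polynomial loss to many-ring constant
loss for JOINT polylog-degree 𝔽₃ strategies on n^K disjoint rings. [deps: PolyLoss3, MultiRingHard3]
[difficulty: open-problem] (why it might fail: joint strategies reading across rings need not lose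
independently, so per-ring polynomial loss may fail to multiply; no direct-product/XOR lemma for
two-moduli relation games is in print (VW08 is GF(2) correlation only).)
[doi:10.4086/toc.2008.v004a007, arXiv:1704.00690]
#9 OddToAll3 (support) — the DICTIONARY odd-class ⟹ all-pattern polynomial loss (k := C+1; the even
class has ≤ 2^(n−1) patterns, `Summit.QuantumAdvantage.AdviceFreeQNC0.card_even_class_le`, n ≥ 2).
PROVED sorry-free in both lens files (`ExactnessDial.PD.polyLoss3_of_polyLossOdd3u`,
`ProductDial.polyLoss3_of_polyLossOddU3`); consumed by closes; shared with ProductDial's layer 2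
(its closes₃ needs the same step). [difficulty: provable-now] [arXiv:1704.00690,
BarringtonStraubingTherien1990]
#9 MultiRingBridge3 (support) — SHARED NODE = ProductDial's bridge MultiRingBridge3 (item
stmt-QuantumAdvantage-26125, support, LOAD-BEARING/STAFF-FIRST; identical signature ⇒ one ledger
item): many-ring hardness ⟹ HLFNotFAC0Mod 3 (adapt `Theorems.hlfNotFAC0Mod_of_ringHard8` to n^K
packed rings). [difficulty: M] [arXiv:1704.00690, doi:10.1145/28395.28404]
#9 PolyLoss3 (support) — SHARED NODE = ProductDial's crux PolyLoss3 (item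
stmt-QuantumAdvantage-26123, rank 2 there; identical signature ⇒ one ledger item): all-pattern
polynomial loss with a UNIFORM exponent k at every polylog degree; in this route it is DERIVED
(OddToAll3 applied to the junction) and consumed by DPLift3. [difficulty: open-problem]
[arXiv:1704.00690, doi:10.4086/toc.2008.v004a007]
#9 MultiRingHard3 (support) — SHARED NODE = ProductDial's reformulated target T* (item
stmt-QuantumAdvantage-26122, target rank 0 there; identical signature ⇒ one ledger item):
constant-fraction loss θ < 1 for JOINT polylog-degree 𝔽₃ strategies on n^K disjoint packed rings;
here the intermediate between DPLift3 and MultiRingBridge3. [difficulty: open-problem]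
[arXiv:1704.00690, doi:10.4086/toc.2008.v004a007]
#9 NoPerfectAffine3 (support) — aside (kind aside, PROVABLE-NOW = the BC5 witness of weakness of
NoPerfectOdd3, tribunal T3): the δ ≡ 1 slice of PIECE 1 — no AFFINE-output 𝔽₃ strategy is perfect on
the odd class of the n-cycle for large n. PROVED sorry-free in the lens files (`noPerfectAt_one` in
ExactnessDial.lean; self-contained `NoPerfectOdd3_rung` in bc/NoPerfectOdd3_rung.lean, rc 0) from
the tree theorem `AffBells37.affBellsPolyLoss3` via the dictionary lowDeg (ZMod 3) N 1 = affine
coefficient functions; the same slice of T (`BondTwist3.RingAffineBellsLt3`) is OPEN — tribunal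
--witness at birth = the tree theorem
`Summit.QuantumAdvantage.AdviceFreeQNC0.AffBells37.affBellsPolyLoss3` (module imported) with
--s-case `BondTwist3.RingAffineBellsLt3`; a prover may land bc/NoPerfectOdd3_rung.lean as
Theorems/ExactnessDialRung.lean. [difficulty: provable-now] [arXiv:1704.00690,
BarringtonStraubingTherien1990]

TWO-LAYER PLAN. NoPerfectOdd3 ⇐ stub_exact_law → stub_schedule → NoPerfectOdd3 (BC3 skeleton
bc/NoPerfectOdd3_birth.lean, rc 0, sorries = stubs = 2): the POLYNOMIAL
EXACT LAW «∃ A k, no perfect degree-d strategy on C_n once n ≥ A(d+1)^k» (𝔽₃ analogue of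
`fullSpan_perfect_iff`, stated with ∃) plus the
provable-now schedule lemma. MassStep3u ⇐ (fibre globalisation) → (per-fibre dichotomy, tree) →
MassStep3u — T3-plan-only: the first stub is the
IDEA-NEEDED globalisation statement, typed by the crux chain once the census min-loss data is in.
Shape-A decls (ExactLift3, PolyLossOdd3, MassStep3,
ConstStep3) are TREE RECORDS only (critic ruling 02:58:45Z).

KILL CRITERIA. A refutation of NoPerfectOdd3 (an N-extensible PERFECT polylog-degree family on the
odd class) refutes `RingHardOdd 3`, ProductDial's junction
PolyLossOddU3 and this route: close --reason refuted:NoPerfectOdd3. A refutation of MassStep3u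
(exact grade true but a family with n^(−ω(1)) odd
loss) refutes PolyLossOddU3 hence `RingHardOdd 3` and ProductDial's layer 2: close --reason
refuted:MassStep3u (NoPerfectOdd3 survives as a banked
target). DPLift3 refuted ⇒ ProductDial and this route are BROKEN together (pivot: back to shape A's
ConstStep3 = fibre ceiling, or retire).
PolyLossOddU3 proved elsewhere moots both cruxes (superseded --by
route-QuantumAdvantage-ProductDial).

NOT DECOMPOSED YET. The two-moduli seam inside NoPerfectOdd3 is ONE IDEA-NEEDED block (first open
rung: the exact grade at quadratic outputs, NoPerfectAt (fun _ => 2)).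
MassStep3u is left whole until the census E2/E3 min-loss decay reports (it decides whether «poly» is
even the right grade above degree 1).

CHEAPEST FALSIFIER. Census test E2 (non-local, finite, a few core-hours): shift-COVARIANT strategies
P_k(x) = P₀(rot_k x) with P₀ = affine form + s ≤ 3 quadratic
monomials over 𝔽₃, N = 8…14 — is there a PERFECT one on the odd class beyond N = 7, and does the
pattern extend in N? One N-extensible perfect
family at degree ≤ 2 kills NoPerfectOdd3, RingHardOdd 3, DWalkThree:22907 and DegreeDial's lift at
once (the highest-value shared falsifier on the
p = 3 rung, critic row 10); n* finite in every class = ladder data for the dial. E3: the full affine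
N = 8 instance left UNKNOWN by kissat after 3 h
(AffBells23PerfectSeven.lean header) through the algebraic encoding (u_b = 1 − (P_b − 1)² quadratic
in the coefficients, one equation
∏_{b∈J(x)}(1 + u_b(x)) = (−1)^{s(x)} per odd x) with the dihedral symmetry broken. Not yet run (kit
not allowed to the lens; named to
decomp-qadv-census-1; the running kit j337589 covers translation-invariant LOCAL rules only, whose
cells are theorems).

NUMBERS. Perfect affine strategy EXISTS at N = 7 (`AffBells23.perfect_seven`; threshold of
`noPerfectAt_one` ≥ 8, `noPerfectAffineBells3_threshold`);
affine outputs lose ≥ N^{−e}·2^(N−1) for N ≥ 200 (`AffBells37.affBellsPolyLoss3`); 𝔽₂ sibling: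
perfect full degree-D strategies on m bits iff
m ≤ 2D + 2 (`fullSpan_perfect_iff`), ring exact resolvents need degree ≥ ⌊(n−1)/2⌋ for 5 ≤ n ≤ 12
(`ringExactLowerBound_*`, data to n = 14);
local radius-polylog rules: constant loss PROVED (`ringLocal_polylog_lt3`); refuted constants: θ =
1/2 (`RingHardOddHalf`, negatives); the
leaf needs only some θ < 1; NoPerfectOdd3 names no constant.

DEFINITION REQUESTS. None (all statements are inlined over Literature / AdviceFreeQNC0 declarations;
the four shared nodes carry ProductDial's signatures verbatim).

Novelty: Searches (2026-08-30): tree `rg 'NoPerfect|not_perfect|perfect_iff'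
lean/Summits/QuantumAdvantage/AdviceFreeQNC0` (p = 3: affine only — `NoPerfectAffineBells3`,
conditional proofs `noPerfect_of_ringAffineBellsLt3`, `noPerfectAffineBells3_of_S26*`, fibre-level
`FibreNonExact37*`; nothing at output degree ≥ 2; p = 2: `fullSpan_perfect_iff`,
`fullSpan_not_perfect`, `ringExactLowerBound_*`), `rg 'RingHardOddPoly|ImperfectFibreMass'` (memo /
affine), `rg '^def Ring.*Local|Junta'` (local cells proved), `ledger negatives --problem
QuantumAdvantage` (WalkHardF 3, RingHardOddHalf respected); corpus `lit search --hybrid "exact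
computation relation problem low degree polynomials mod 3 shallow circuits"` and `lit vsearch "no
constant-depth circuit with mod 3 gates solves the hidden linear function problem on every input"`
([corpus:book:jukna2012-boolean-function-complexity-advances-frontiers p.368] Razborov–Smolensky
exact/approximate MOD_q over 𝔽_p — functions, not relations); galaxy `lit galaxy search "hidden
linear function|parity halving|graph state" --star all` and `"relation problem|AC0[p]|exactly
solves" --star pdf` (hits: BGK 2018 = arXiv:1704.00690 §4 worst-case NC⁰ via cycle gadgets; WKST19 =
arXiv:1906.08890 AC⁰ average-case with switching lemmas; Grier–Schaeffer arXiv:1911.02555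
interactive; none for AC⁰[3] / 𝔽₃-polynomials, exact or not).
Nearest prior art found: arXiv:1704.00690 §4.1 (BGK: no NC⁰ circuit solves the cycle/2D HLF relation
on all inputs — light-cone argument,  [refs: 1704.00690, 1906.08890, 1911.02555, book:jukna2012-boolean-function-complexity-advances-frontiers]

Barriers (technique_class: decomposition, polynomial-method, two-moduli-correlation): - technique_class: decomposition, polynomial-method, two-moduli-correlation
- Literature.Barriers.QuantumAdvantage.TwoModuliDepthTwo: NoPerfectOdd3 and MassStep3u sit OUTSIDE
its technique class (exactness / a polynomial odd-class loss are not depth-two correlation bounds;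
the barrier theorem does not quantify over the ring relation — critic row 10); shape B has NO binder
that must beat it head-on (shape A's ConstStep3, the fibre ceiling, is dropped); the many-ring
content sits in ProductDial's DPLift3, placed there against Viola–Wigderson
doi:10.4086/toc.2008.v004a007 Thm 1.2 / Cor 1.6 (correlation with low-degree GF(2) polynomials; our
players are 𝔽₃-valued with constant-sign constraints — outside as typed, per critic row 9).
- Literature.Barriers.QuantumAdvantage.NonclassicalDegreeLogBarrier: does NOT bite — it caps
CORRELATION bounds below 1/√n at degree ≥ log₂ n (`bhowmickLovett_thm31`); NoPerfectOdd3 asks no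
correlation bound at all and the lift asks only a constant θ < 1.
- Literature.Barriers.QuantumAdvantage.NaturalProofs: inside-and-unobstructed — bounds against
polylog-degree 𝔽₃-polynomial tuples, a class without PRFs.
- Literature.Barriers.QuantumAdvantage.Relativization: does not quantify over a fixed combinatorial
statement on the n-cycle relation (no oracle; rung, not BQP ⊄ BPP).
- Literature.Barriers.QuantumAdvantage.Algebrization: idem — no class separation is claimed.
- Literature.Barriers.QuantumAdvantage.SeparationPrerequisites: idem — a rung leaf (advice-

History (route lifecycle, newest last):
- 2026-08-30T06:21:21Z · rev 3: informal re-worded for NoPerfectTwo3 (planner-decomp-qadv-writer-1-g3-0)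
- 2026-08-30T07:17:12Z · rev 4: informal re-worded for NoPerfectTwo3, MultiRingBridge3 (planner-decomp-qadv-writer-1-g3-0)
- 2026-08-30T08:24:13Z · rev 5: informal re-worded for NoPerfectConst3, NoPerfectTwo3 (planner-decomp-qadv-writer-1-g4-0)
- 2026-08-30T10:07:57Z · rev 6: informal re-worded for NoPerfectConst3 (planner-decomp-qadv-writer-1-g4-0)
- 2026-08-30T12:08:33Z · rev 7: informal re-worded for NoPerfectTwo3, NoPerfectConst3 (planner-decomp-qadv-writer-1-g5-0)
- 2026-08-30T13:06:34Z · rev 8: informal re-worded for PolyLossOddU3, OddToAll3 (planner-decomp-qadv-writer-1-g5-0)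
- 2026-08-30T15:42:59Z · rev 9: informal re-worded for PolyLossOddU3 (planner-decomp-qadv-writer-1-g5-0)

sub-problem: QuantumAdvantage · status: draft · opened planner-decomp-qadv-writer-1-g2-0 2026-08-30T03:18:36Z · rev 9 · ledger route-QuantumAdvantage-ExactnessDial
GENERATED by the gate from the ledger (D-0016/17). Provers cite these decls: `theorem foo : Summit.QuantumAdvantage.QuantumAdvantage.Theses.ExactnessDial.<Decl> := …` in Summits/QuantumAdvantage/QuantumAdvantage/Theorems/<Name>.lean.
-/

namespace Summit.QuantumAdvantage.QuantumAdvantage.Theses.ExactnessDial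

open scoped BigOperators Topology Manifold Classical MeasureTheory ProbabilityTheory Matrix InnerProductSpace ComplexConjugate ContinuousMap
open Filter Set Function TopologicalSpace MeasureTheory

attribute [summit_statement] _root_.QuantumAdvantage
attribute [summit_statement] _root_.Summit.QuantumAdvantage.AdviceFreeQNC0.AdviceFreeQNC0Three

open Literature.QuantumAdvantage

/-- item stmt-QuantumAdvantage-26531 · target · rank 0 · open · by planner
why it might fail: false iff either the exact grade fails (a perfect polylog-degree family) or some family loses only an n^(−ω(1)) fraction of the odd class; nothing is known above output degree 1.
sources: arXiv:1704.00690, BarringtonStraubingTherien1990, doi:10.4086/toc.2008.v004a007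
[target] THE JUNCTION X (shared with ProductDial's layer 2; critic grammar 02:48:23Z, ∃C ∀c — the
STRONG quantifier order ProductDial's direct product needs): ONE exponent C such that at every
polylog output degree (log₂ n)^c, for all large n, every 𝔽₃-polynomial strategy wins at most (1 −
n^(−C))·2^(n−1) of the ODD patterns of the n-cycle ring relation. NECESSARY for T = `RingHardOdd 3`
(C := 1, lens kernels `polyLossOdd3u_of_ringHardOdd` / `polyLossOddU3_of_ringHardOdd`); implies
ProductDial's PolyLoss3 (OddToAll3, k := C+1) and lens-1's PolyLossOdd3 trivially; its degree-1
slice is the tree theorem `AffBells37.affBellsPolyLoss3` ON THE NOSE (lens-5 `oddLossAt_one`);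
`ExactnessDial.PolyLossOdd3u ↔ ProductDial.PolyLossOddU3 := Iff.rfl` (critic merged farm check
02:59:21Z). Here X ⟺ NoPerfectOdd3 ∧ MassStep3u (`node_iff_B`). [deps: NoPerfectOdd3, MassStep3u]
[difficulty: open-problem] LEADER RECORD (2026-08-30; lens-2 g12 «LeaderDial» node 47ef054c, 1154 l,
farm rc0 · 0 sorry · 0 warn · axioms std · bc P1–P8 must-fail FAIL; critic row 57 VERIFIED HIGH,
LAW-node; NO items — caps; residuals recorded): ONE-POLYNOMIAL NORMAL FORM — `symLaw3 :
PolyLossOddU3 ↔ CovPolyLossOddU3` PROVED bo -/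
@[route_item "route-QuantumAdvantage-ExactnessDial", crux]
def PolyLossOddU3 : Prop :=
  ∃ C : ℕ, ∀ c : ℕ, ∃ n₀ : ℕ, ∀ n ≥ n₀, ∀ P : Fin n → Literature.Computability.MetaComplexity.Smolensky.CubeFn (ZMod 3) n, (∀ i, P i ∈ Literature.Computability.MetaComplexity.Smolensky.lowDeg (ZMod 3) n ((Nat.log 2 n) ^ c)) → ((Finset.univ.filter fun x : Fin n → Bool => Summit.QuantumAdvantage.AdviceFreeQNC0.OddZeros x ∧ Literature.Computability.QuantumComplexity.RingHLF.Rel x (fun i => decide (P i x = 1))).card : ℝ) ≤ (1 - 1 / (n : ℝ) ^ C) * (2 : ℝ) ^ (n - 1)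

/-- item stmt-QuantumAdvantage-26532 · crux · rank 2 · SPLIT (gen 1) into NoPerfectConst3, ConstLift3 + glue ConstSplitGlue3 · direct attempts still welcome (low priority) · by planner
why it might fail: an N-extensible family of PERFECT quadratic (or bounded-degree, non-local) strategies may exist for infinitely many N — a perfect affine one exists at N = 7 — which would refute the parent RingHardOdd 3 itself.
sources: arXiv:1704.00690, doi:10.1007/BF01200404, doi:10.1145/28395.28404, arXiv:1911.02555
[crux] PIECE 1, the EXACT GRADE of the loss dial at every polylog degree: for every c, for all large
n, no 𝔽₃-polynomial strategy with outputs of degree ≤ (log₂ n)^c (output bits z_i = [P_i(x) = 1])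
satisfies the n-cycle ring relation `RingHLF.Rel` on every odd pattern. NECESSARY (lens kernel
`noPerfectOdd3_of_ringHardOdd`) · WEAKER-GENUINE (exact vs constant loss; its δ ≡ 1 slice
`noPerfectAt_one` is a THEOREM while T's δ ≡ 1 slice `RingAffineBellsLt3` is open) · OPEN above
degree 1, critic-tested NOT a theorem shadow (only the affine cell and the LOCAL cells
`ringLocal_polylog_lt3` / `ringLocalJunta_polylog_lt3` are landed; a PERFECT affine strategy exists
at N = 7, `AffBells23.perfect_seven`, so any proof is genuinely asymptotic) · FLOOR-FREE ·
QUANTUM-CONTENTFUL · ATTACK = IDEA-NEEDED at the two-moduli seam (first lemma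
`rel_iff_subcubeParity` proved; transfer target `fullSpan_perfect_iff`; first non-transferring step:
𝔽₃-selectors [P = 1] = 2t + 2t² have no 𝔽₂-character-span description) · INSTRUMENTABLE (finite
𝔽₃-variety per (N, d); census tests: E1 shift-covariant affine N = 8…20 = ladder data n*_cov(1) only
(finite-N shadow of the theorem `noPerfectAt_one`); E2 covariant a -/
@[route_item "route-QuantumAdvantage-ExactnessDial", crux]
def NoPerfectOdd3 : Prop :=
  ∀ c : ℕ, ∃ n₀ : ℕ, ∀ n ≥ n₀, ∀ P : Fin n → Literature.Computability.MetaComplexity.Smolensky.CubeFn (ZMod 3) n, (∀ i, P i ∈ Literature.Computability.MetaComplexity.Smolensky.lowDeg (ZMod 3) n ((Nat.log 2 n) ^ c)) → ∃ x : Fin n → Bool, Summit.QuantumAdvantage.AdviceFreeQNC0.OddZeros x ∧ ¬ Literature.Computability.QuantumComplexity.RingHLF.Rel x (fun i => decide (P i x = 1))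

-- parent: NoPerfectOdd3 · child (gen 1)
/--     item stmt-QuantumAdvantage-27380 · crux · rank 201 · open
    parent: NoPerfectOdd3 · by planner
    why it might fail: an n-extensible family of perfect quadratic (or cubic level-steered) strategies for infinitely many n — the measured thresholds n₁(1) ≥ 7, n₁(2) ≥ 8 leave room (census (B) reading rule: n₁(d) ≈ 2^Θ(d) is the ExactDegreeLog signature).
    sources: arXiv:1704.00690, doi:10.1109/SFCS.1993.366874, Summit.QuantumAdvantage.AdviceFreeQNC0.AffBells37.affBellsPolyLoss3, kit:j337947
[crux] PIECE 1 of the glued split of NoPerfectOdd3 (stmt-QuantumAdvantage-26532; lens-1 g3 node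
DegreeGrowthDial sha256 bb8a8a2b…, critic row 18 CLEARED 2026-08-30T03:52:24Z) — the GROWTH grade
«d₃*(n) → ∞»: for every constant d, for all large n, no strategy with outputs of 𝔽₃-degree ≤ d is
perfect on the odd class of the n-cycle. NECESSARY (T′ = NoPerfectOdd3 → it and T = RingHardOdd 3 →
it PROVED in the node); WEAKER-GENUINE (fixed d vs (log₂ n)^c); INSTRUMENTABLE cell-by-cell
(PerfectAt n d decidable; kernel certificates d₃*(5) = d₃*(6) = d₃*(7) = 1 and d₃*(8) ≤ 2,
perfectAt_eight_two = census (A) E2's shift-covariant quadratic rule); rung d = 1 is the THEOREM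
NoPerfectAffine3 = stmt-26535 (BC5 witness, noPerfectAffine3 PROVED in the node); FIRST OPEN RUNG d
= 2 = aside NoPerfectTwo3. [deps: none] [difficulty: L] SPARSE-ACTIVE DIAL RECORD 2026-08-30 (lens-2
g8 node SparseDial rev 1 sha256 3f1a9b0e… 1088 l, rc0 · 0 sorry, axioms std; critic row 42 CLEARED
08:22:44Z as a LAW / SUPPORT node, NOT a split — NoPerfect d ↔ DenseLose d K is PROVED for every K,
↔ NetLose d; no DenseLose/NetLose item): AXIS = number of ACTIVE outputs (outputs deviating on the
odd class from the canonical -/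
@[route_item "route-QuantumAdvantage-ExactnessDial"]
def NoPerfectConst3 : Prop :=
  ∀ d : ℕ, ∃ n₀ : ℕ, ∀ n ≥ n₀, ∀ P : Fin n → Literature.Computability.MetaComplexity.Smolensky.CubeFn (ZMod 3) n, (∀ i, P i ∈ Literature.Computability.MetaComplexity.Smolensky.lowDeg (ZMod 3) n d) → ∃ x : Fin n → Bool, Summit.QuantumAdvantage.AdviceFreeQNC0.OddZeros x ∧ ¬ Literature.Computability.QuantumComplexity.RingHLF.Rel x (fun i => decide (P i x = 1))

-- parent: NoPerfectOdd3 · child (gen 1)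
/--     item stmt-QuantumAdvantage-27381 · crux · rank 202 · open
    parent: NoPerfectOdd3 · by planner
    why it might fail: d₃*(n) may tend to infinity only logarithmically (ExactDegreeLog3 / its IO form: perfect strategies of degree C·log₂ n for infinitely many n), in which case NoPerfectConst3 holds and T′ fails.
    sources: doi:10.1109/SFCS.1993.366874, arXiv:1906.08890, kit:j337947
[crux] PIECE 2, DECLARED RESIDUAL (NO-SHRINK relative to T′ = NoPerfectOdd3: ≡ T′ mod
NoPerfectConst3; T′-grade, itself strictly below T since 26532 is ExactnessDial's open-W binder):
from «d₃* → ∞» to «d₃* super-polylogarithmic» — the growth-RATE content of T′. Vacuously necessary;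
UNDECIDED; no plan claimed (the residual is declared, not hidden). Kill lane: ExactDegreeLogIO3
(aside) ⇒ ¬T′ while NoPerfectConst3 survives. [deps: NoPerfectConst3] [difficulty: open-problem] -/
@[route_item "route-QuantumAdvantage-ExactnessDial"]
def ConstLift3 : Prop :=
  NoPerfectConst3 → NoPerfectOdd3

-- parent: NoPerfectOdd3 · glue (gen 1)
/--     item stmt-QuantumAdvantage-27382 · support · rank 203 · open
    parent: NoPerfectOdd3 · GLUE: children ⟹ parent · by planner
NoPerfectConst3 → ConstLift3 → NoPerfectOdd3 (modus ponens: ConstLift3 := NoPerfectConst3 →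
NoPerfectOdd3; node closes_exact := fun h₁ h₂ => h₂ h₁) -/
@[route_item "route-QuantumAdvantage-ExactnessDial"]
def ConstSplitGlue3 : Prop :=
  NoPerfectConst3 → ConstLift3 → NoPerfectOdd3

/-- item stmt-QuantumAdvantage-26533 · crux · rank 3 · open · by planner
why it might fail: a polylog-degree family losing a non-zero but n^(−ω(1)) fraction of the odd inputs refutes it while NoPerfectOdd3 survives; nothing is known above output degree 1 and no amplification for two-moduli games is in print.
sources: BarringtonStraubingTherien1990, arXiv:1704.00690, doi:10.1016/j.jcss.2004.01.003
[crux] PIECE 2′, DECLARED-RESIDUAL(NoPerfectOdd3) of PolyLossOddU3-grade (NOT T-grade; seam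
`node_iff_B : PolyLossOddU3 ↔ NoPerfectOdd3 ∧ MassStep3u`): ONE LOSS ⇒ POLYNOMIAL LOSS with one
exponent for all polylog degrees — if no polylog-degree 𝔽₃ strategy is perfect on the odd class,
then some C bounds the odd-class win count of every polylog-degree strategy by (1 − n^(−C))·2^(n−1).
Vacuous-NECESSARY (`massStep3u_of_ringHardOdd`); at δ ≡ 1 BOTH ends are theorems (`noPerfectAt_one`;
ProductDial `oddLossAt_one` = AffBells37). Mechanism question of record: globalise the cell's
per-fibre dichotomy «exact-or-polynomial-loss ON A FIBRE»
(`ParityModTestDensity.two_pow_le_card_filter_parityMod3_coset`, ROUND-38P2 Thm 38.Z) from affine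
fibres to polylog-degree strategies — IDEA-NEEDED; UNDECIDED with census test «minimum odd-class
loss in the E2/E3 classes, N = 8…20: N^(−C) decay vs sub-polynomial vs 0». [deps: NoPerfectOdd3]
[difficulty: open-problem] -/
@[route_item "route-QuantumAdvantage-ExactnessDial", crux (bottleneck := idea) (source := "ledger wanted_by.residual on stmt-QuantumAdvantage-26533, 2026-09-01")]
def MassStep3u : Prop :=
  NoPerfectOdd3 → PolyLossOddU3

/-- item stmt-QuantumAdvantage-26122 · support · rank 9 · open · by planner
sources: arXiv:1704.00690, doi:10.4086/toc.2008.v004a007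
[target] T* (the reformulated target, rank 0; assembly conclusion of layer 2): there are K and θ < 1
such that for every c, for all large n, every joint strategy for n^K rings of length n whose outputs
are 𝔽₃-polynomials of degree ≤ (log₂ n)^c in all n^K·n input bits wins all rings (each ring's output
satisfies RingHLF.Rel) on at most θ·2^(n^K·n) input tuples. T → T* proved (node file
`multiRingHard3_of_ringHardOdd`); T* → PolyLoss3 proved (`polyLoss3_of_multiRingHard3`). [deps:
PolyLoss3, DPLift3] [difficulty: open-problem] -/
@[route_item "route-QuantumAdvantage-ExactnessDial"]
def MultiRingHard3 : Prop :=
  ∃ K : ℕ, ∃ θ : ℝ, θ < 1 ∧ ∀ c : ℕ, ∃ n₀ : ℕ, ∀ n ≥ n₀, ∀ P : Fin (n ^ K) → Fin n → Literature.Computability.MetaComplexity.Smolensky.CubeFn (ZMod 3) (n ^ K * n), (∀ j i, P j i ∈ Literature.Computability.MetaComplexity.Smolensky.lowDeg (ZMod 3) (n ^ K * n) ((Nat.log 2 n) ^ c)) → ((Finset.univ.filter fun X : Fin (n ^ K) → Fin n → Bool => ∀ j, Literature.Computability.QuantumComplexity.RingHLF.Rel (X j) (fun i => decide (P j i (fun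 k => X (finProdFinEquiv.symm k).1 (finProdFinEquiv.symm k).2) = 1))).card : ℝ) ≤ θ * (2 : ℝ) ^ (n ^ K * n)

/-- item stmt-QuantumAdvantage-26123 · support · rank 9 · open · by planner
sources: arXiv:1704.00690, doi:10.4086/toc.2008.v004a007
[crux] inverse-polynomial single-ring loss at every polylog degree: some k such that for every c,
for all large n, every single-ring 𝔽₃-strategy (z_i = [P_i(x) = 1], deg P_i ≤ (log₂ n)^c) satisfies
the n-cycle relation RingHLF.Rel on at most (1 − n^(−k))·2^n of ALL 2^n inputs (plain count).
Strictly weaker than T (T ⇒ PolyLoss3, `polyLoss3_of_ringHardOdd`) and than AffineCore3's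
constant-loss demand; degree-1 slice PROVED (`polyLossOne3`, from the tree's
AffBells37.affBellsPolyLoss3). [difficulty: L] -/
@[route_item "route-QuantumAdvantage-ExactnessDial", crux]
def PolyLoss3 : Prop :=
  ∃ k : ℕ, ∀ c : ℕ, ∃ n₀ : ℕ, ∀ n ≥ n₀, ∀ P : Fin n → Literature.Computability.MetaComplexity.Smolensky.CubeFn (ZMod 3) n, (∀ i, P i ∈ Literature.Computability.MetaComplexity.Smolensky.lowDeg (ZMod 3) n ((Nat.log 2 n) ^ c)) → ((Finset.univ.filter fun x : Fin n → Bool => Literature.Computability.QuantumComplexity.RingHLF.Rel x (fun i => decide (P i x = 1))).card : ℝ) ≤ (1 - 1 / (n : ℝ) ^ k) * (2 : ℝ) ^ n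

/-- item stmt-QuantumAdvantage-26124 · crux · rank 4 · open · by planner
why it might fail: joint strategies reading across rings need not lose independently, so per-ring polynomial loss may fail to multiply; no direct-product/XOR lemma for two-moduli relation games is in print (VW08 is GF(2) correlation only).
sources: doi:10.4086/toc.2008.v004a007, arXiv:1704.00690
[crux] DECLARED-RESIDUAL (NO-SHRINK piece, critic row 9): the direct-product lift PolyLoss3 →
MultiRingHard3 — an inverse-polynomial loss per ring at every polylog degree amplifies, over n^K
disjoint rings read JOINTLY, to a constant all-rings bound. Proved special cases in the node file:
separable strategies (`dpSeparable3`) and triangular/causal reading orders (`dpTriangular3`,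
induction over rings via `card_winAllSet_triangular_le`); the symmetric cross-reading case is the
open content; constant-degree sub-rung DPLiftConst3 filed as aside. [deps: PolyLoss3] [difficulty:
open-problem] -/
@[route_item "route-QuantumAdvantage-ExactnessDial", crux (bottleneck := idea) (source := "ledger D-0171 leaf tag IDEA-NEEDED on stmt-QuantumAdvantage-26124, 2026-09-01")]
def DPLift3 : Prop :=
  PolyLoss3 → MultiRingHard3

/-- item stmt-QuantumAdvantage-26125 · support · rank 9 · closed · proved by Summit.QuantumAdvantage.QuantumAdvantage.Theorems.pencilDial_multiRingBridge3 (prover) · by planner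
sources: arXiv:1704.00690, doi:10.1145/28395.28404
[support] LOAD-BEARING support (binder of `closes`; critic: staff/land FIRST): T* feeds the
registered leaf hypothesis — MultiRingHard3 → HLFNotFAC0Mod 3: restrict N×N 2D-HLF circuits over
accBasis 3 to instances carrying n^K disjoint square cycles of length n, turn the FAC⁰[3] circuit
tuple into ONE joint polylog-degree 𝔽₃-strategy for all rings at once by the relational
Razborov–Smolensky lemma (tree `Smolensky.exists_uniformProb_le`, error counted once for the whole
tuple), transfer HLF solutions to ring wins ring by ring (tree `GridCycle.rel_of_mem_hlfSolutions`),
exactly as the single-ring bridge `Theorems.hlfNotFAC0Mod_of_ringHard8` (RingFrameBridge.lean:119)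
with the packing of n^K cycles replacing one 8t-cycle. [difficulty: M] STATUS 2026-08-30 (record
correction): PROVED in a LAND-READY file — BridgeDial (lens-5 g6) Theorems/MultiRingBridge.lean
sha256 d782ca8a… (832 l, farm rc0 · 0 sorry): `Theorems.productDial_multiRingBridge3 :
ProductDial.MultiRingBridge3` (this shared decl — closes the item in all six routes) and
`adviceFreeQNC0Three_of_multiRingHard3 : MultiRingHard3 → AdviceFreeQNC0Three`; attached as evidence
on this item; LAND FIRST `ledger propose --kind proof -- -/
@[route_item "route-QuantumAdvantage-ExactnessDial", crux]
def MultiRingBridge3 : Prop :=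
  MultiRingHard3 → Summit.QuantumAdvantage.AdviceFreeQNC0.HLFNotFAC0Mod 3

-- `MultiRingBridge3` holds: proved by `Summit.QuantumAdvantage.QuantumAdvantage.Theorems.pencilDial_multiRingBridge3` (its module imports this route file, so no `_holds` link can be stated here).

/-- item stmt-QuantumAdvantage-26534 · support · rank 9 · closed · proved by Summit.QuantumAdvantage.QuantumAdvantage.Theorems.ExactnessDialOddToAll.exactnessDial_oddToAll3 (prover) · by planner
sources: arXiv:1704.00690, BarringtonStraubingTherien1990
[support] the DICTIONARY odd-class ⟹ all-pattern polynomial loss (k := C+1; the even class has ≤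
2^(n−1) patterns, `Summit.QuantumAdvantage.AdviceFreeQNC0.card_even_class_le`, n ≥ 2). PROVED
sorry-free in both lens files (`ExactnessDial.PD.polyLoss3_of_polyLossOdd3u`,
`ProductDial.polyLoss3_of_polyLossOddU3`); consumed by closes; shared with ProductDial's layer 2
(its closes₃ needs the same step). [difficulty: provable-now] PROVED 2026-08-30 in lens-2 g12
«LeaderDial» node 47ef054c (`oddToAll3`: odd ⟹ all dictionary, k := C+1; critic row 57
kernel-confirmed proof-of-item `exactnessDial_oddToAll3 ⊢ Theses.ExactnessDial.OddToAll3`); closes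
on landing of HOME/decomp-qadv-lens-2/g12/tree/ExactnessDialOddToAll.lean (eba11686, stand-alone,
farm rc0 audit ok) --workitem stmt-QuantumAdvantage-26534 (census/prover lane). -/
@[route_item "route-QuantumAdvantage-ExactnessDial", crux]
def OddToAll3 : Prop :=
  PolyLossOddU3 → PolyLoss3

-- `OddToAll3` holds: proved by `Summit.QuantumAdvantage.QuantumAdvantage.Theorems.ExactnessDialOddToAll.exactnessDial_oddToAll3` (its module imports this route file, so no `_holds` link can be stated here).

/-- item stmt-QuantumAdvantage-26535 · aside · rank 9 · open · by planner
sources: arXiv:1704.00690, BarringtonStraubingTherien1990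
[support] aside (kind aside, PROVABLE-NOW = the BC5 witness of weakness of NoPerfectOdd3, tribunal
T3): the δ ≡ 1 slice of PIECE 1 — no AFFINE-output 𝔽₃ strategy is perfect on the odd class of the
n-cycle for large n. PROVED sorry-free in the lens files (`noPerfectAt_one` in ExactnessDial.lean;
self-contained `NoPerfectOdd3_rung` in bc/NoPerfectOdd3_rung.lean, rc 0) from the tree theorem
`AffBells37.affBellsPolyLoss3` via the dictionary lowDeg (ZMod 3) N 1 = affine coefficient
functions; the same slice of T (`BondTwist3.RingAffineBellsLt3`) is OPEN — tribunal --witness at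
birth = the tree theorem `Summit.QuantumAdvantage.AdviceFreeQNC0.AffBells37.affBellsPolyLoss3`
(module imported) with --s-case `BondTwist3.RingAffineBellsLt3`; a prover may land
bc/NoPerfectOdd3_rung.lean as Theorems/ExactnessDialRung.lean. [difficulty: provable-now] -/
@[route_item "route-QuantumAdvantage-ExactnessDial"]
def NoPerfectAffine3 : Prop :=
  ∃ n₀ : ℕ, ∀ n ≥ n₀, ∀ P : Fin n → Literature.Computability.MetaComplexity.Smolensky.CubeFn (ZMod 3) n, (∀ i, P i ∈ Literature.Computability.MetaComplexity.Smolensky.lowDeg (ZMod 3) n 1) → ∃ x : Fin n → Bool, Summit.QuantumAdvantage.AdviceFreeQNC0.OddZeros x ∧ ¬ Literature.Computability.QuantumComplexity.RingHLF.Rel x (fun i => decide (P i x = 1))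

/-- item stmt-QuantumAdvantage-27432 · aside · rank 9 · open · by planner
sources: arXiv:1704.00690, kit:j337947
[aside] RUNG d = 2 of NoPerfectConst3 — THE FIRST OPEN RUNG «d₃*(n) ≥ 3 eventually» (lens-1 g3
DegreeGrowthDial :251 verbatim; critic row 18: the attackable item, wanted): for all large n, no
strategy with outputs of 𝔽₃-degree ≤ 2 is perfect on the odd class. WEAKER than NoPerfectConst3
(node noPerfectTwo3_of_noPerfectConst3); OPEN; INSTRUMENTED: census (B) d = 2, N = 8…12; datum n₁(2)
≥ 8 (kernel certificate perfectAt_eight_two = census (A) E2's shift-covariant quadratic rule). Why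
it might fail: an n-extensible family of perfect quadratic strategies. Sources: arXiv:1704.00690;
kit:j337947. RANK DIAL RECORD 2026-08-30 (lens-2 g6 NODE «RankDial», critic rows 31/31v2): 27432 ⟺
LowRankNotPerfect3 r ∧ HighRankNotPerfect3 r for every threshold r (`noPerfectTwo3_iff_rank`,
PROVED); the LOW cube-rank side r = rkLin n = (n−8)/12 − 2·log₂ n is PROVED
(`RankDialForms.lowRankNotPerfect3_lin`, via `perfectTwo_forces_highRank_output`: a perfect degree-2
strategy must have SOME output of cube-rank > rkLin) — so 27432 ≡ HighRankNotPerfect3 rkLin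
(`noPerfectTwo3_iff_highRank`): the OPEN part is some output of linear cube-rank. Dial rung at half
rank filed as FormsDichotomy aside LowRankNotPerfect -/
@[route_item "route-QuantumAdvantage-ExactnessDial"]
def NoPerfectTwo3 : Prop :=
  ∃ n₀ : ℕ, ∀ n ≥ n₀, ∀ P : Fin n → Literature.Computability.MetaComplexity.Smolensky.CubeFn (ZMod 3) n, (∀ i, P i ∈ Literature.Computability.MetaComplexity.Smolensky.lowDeg (ZMod 3) n 2) → ∃ x : Fin n → Bool, Summit.QuantumAdvantage.AdviceFreeQNC0.OddZeros x ∧ ¬ Literature.Computability.QuantumComplexity.RingHLF.Rel x (fun i => decide (P i x = 1))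

/-- item stmt-QuantumAdvantage-27433 · aside · rank 9 · open · by planner
sources: doi:10.1109/SFCS.1993.366874, kit:j337947
[aside] REFUTER LANE of the split (critic row 18's sharpened IO form of the node's ExactDegreeLog3):
for some C, for INFINITELY MANY n, some strategy of 𝔽₃-degree ≤ C·log₂ n is PERFECT on the odd class
of the n-cycle. ⇒ ¬NoPerfectOdd3 (26532) and ¬RingHardOdd 3 (since C·log₂ n ≤ (log₂ n)² eventually;
node exactDegreeLog3_refutes for the ∀n form) while NoPerfectConst3 may survive — the world in which
the residual ConstLift3 is false. Census (B) reading rule: thresholds n₁(d) ≈ 2^Θ(d) across d =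
1,2,3 are this statement's signature. Sources: doi:10.1109/SFCS.1993.366874; kit:j337947. -/
@[route_item "route-QuantumAdvantage-ExactnessDial"]
def ExactDegreeLogIO3 : Prop :=
  ∃ C : ℕ, ∀ n₀ : ℕ, ∃ n ≥ n₀, ∃ P : Fin n → Literature.Computability.MetaComplexity.Smolensky.CubeFn (ZMod 3) n, (∀ i, P i ∈ Literature.Computability.MetaComplexity.Smolensky.lowDeg (ZMod 3) n (C * Nat.log 2 n)) ∧ ∀ x : Fin n → Bool, Summit.QuantumAdvantage.AdviceFreeQNC0.OddZeros x → Literature.Computability.QuantumComplexity.RingHLF.Rel x (fun i => decide (P i x = 1))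

/-- item stmt-QuantumAdvantage-26536 · assembly · rank 1 · open · by planner
sources: arXiv:1704.00690, doi:10.1145/28395.28404
[assembly] NoPerfectOdd3 → MassStep3u → OddToAll3 → DPLift3 → MultiRingBridge3 → the rung leaf
AdviceFreeQNC0Three; the same one-line script as closes. -/
@[route_item "route-QuantumAdvantage-ExactnessDial"]
def Assembly : Prop :=
  NoPerfectOdd3 → MassStep3u → OddToAll3 → DPLift3 → MultiRingBridge3 → Summit.QuantumAdvantage.AdviceFreeQNC0.AdviceFreeQNC0Three

/-! D-0027 §2.1 — DECIDING THEOREM (planner-authored via `route open/edit --closes-file`; by planner-decomp-qadv-writer-1-g2-0 2026-08-30T03:18:36Z):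
its hypotheses are this route's items and its conclusion the registered leaf `Summit.QuantumAdvantage.AdviceFreeQNC0.AdviceFreeQNC0Three` (rung F-Q1-p3, D-0061) (glue_lint), and it elaborates with this file. -/

/-- Deciding theorem of route ExactnessDial (decomp-qadv lens 1 gen 2, SHAPE B): the exact grade `NoPerfectOdd3` and the
one-loss-to-polynomial-loss step `MassStep3u` give the junction `PolyLossOddU3` (odd-class polynomial loss, one exponent at every
polylog degree, shared with ProductDial); the dictionary `OddToAll3` turns it into the all-pattern loss `PolyLoss3`, the shared
direct-product lift `DPLift3` gives T* = `MultiRingHard3`, the shared bridge `MultiRingBridge3` gives `HLFNotFAC0Mod 3`, and the landed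
`Theorems.adviceFreeQNC0Sep_of_hlfNotFAC0Mod` with `adviceFreeQNC0Three_iff` concludes the rung leaf F-Q1-p3. -/
@[closes "route-QuantumAdvantage-ExactnessDial"] theorem closes (hN : NoPerfectOdd3) (hM : MassStep3u) (hO : OddToAll3) (hD : DPLift3) (hB : MultiRingBridge3) :
    Summit.QuantumAdvantage.AdviceFreeQNC0.AdviceFreeQNC0Three :=
  Summit.QuantumAdvantage.AdviceFreeQNC0.adviceFreeQNC0Three_iff.mpr
    (Summit.QuantumAdvantage.QuantumAdvantage.Theorems.adviceFreeQNC0Sep_of_hlfNotFAC0Mod 3 (hB (hD (hO (hM hN)))))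

end Summit.QuantumAdvantage.QuantumAdvantage.Theses.ExactnessDial
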